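import Literature.Analysis.FluidPDE.ClassicalLqRatePressure
import Literature.Analysis.FluidPDE.AssociatedPressureLocalBound
import Literature.Analysis.FluidPDE.ClassicalSolutionRescale
import HarnessLib

/-!
# Chae–Wolf 2017, Theorem 1.1 — the pressure class up to the top time without a restriction on
# the exponent: near/far splitting of the slice pressures

Analysis/FluidPDE proofs file (theorems only; no definitions, no named facts) on the discharge
path of the named facts `Literature.Analysis.FluidPDE.chaeWolf2017_dss_typeI_decay_ge_nine` /
`Literature.Analysis.FluidPDE.chaeWolf2017_dss_typeI_decay` (D. Chae, J. Wolf, *Removing discretely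
self-similar singularities for the 3D Navier–Stokes equations*, Comm. PDE 42 (2017) =
arXiv:1610.09464, **Theorem 1.1**).

The ε-regularity step at a top point `z₀ = (x₀, 0)` ("thanks to [gus] … `z₀` is a regular
point", arXiv p. 7) needs the pressure in `L^{3/2}(Q_ρ(z₀))`. The tree's
`IsClassicalNSSolutionOn.exists_pressure_class_of_rate` (`ClassicalLqRatePressure.lean`) obtains
it from the GLOBAL Calderón–Zygmund bound (2.4b), `‖π(t)‖_{p/2} ≲ ‖u(t)‖_p² ≲ (−t)^{(3−p)/p}`, which
is integrable in time to the power `3/2` only for `p < 9`; for `p ≥ 9` the printed proof switches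
to Wolf's pressure-free criterion [Wolf2015c], absent from the tree. This file obtains the
`L^{3/2}` class for EVERY exponent from LOCAL information instead, by the near/far splitting of
the slice pressure `Q(t)` (the `L^{p/2}` solution of `ΔQ = −∂ᵢ∂ⱼ(uᵢuⱼ)`) around `x₀` — the tree's
Chae–Shvydkoy 2013 Lemma 3.3, `exists_setIntegral_abs_rpow_threeHalves_le`:
`∫_{B(x₀,2ρ)} |Q(t)|^{3/2} ≤ A ∫_{B(x₀,4ρ)} |u(t)|³ + B (2ρ)³ W(t)^{3/2}`,
`W(t) = ∫_{|y|≥4ρ} |u(t, x₀+y)|²/|y|³` — and the smooth renormalisation `m(t) = (Θ ⋆ p(t))(x₀)`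
of `ClassicalLqRatePressure.lean`:

* `lintegral_ball_pressure_sub_le_local` — the slice bound of `p(t) − m(t)` on `B(x₀, ρ)` by the
  LOCAL quantity `∫_{B̄(x₀,ρ)} |Q(t)|^{3/2}` (the average `(Θ ⋆ Q)(x₀)` is controlled by Hölder on
  the ball, `setIntegral_norm_le_of_eLpNorm_le`);
* `IsClassicalNSSolutionOn.exists_pressure_class_of_farField` — **the pressure class on
  `Q_ρ(0, x₀)` for any `q ≥ 3`**, given the near-field input `∫∫_{Q_{4ρ}(0,x₀)} |u|³ < ∞` and a
  uniform far-field bound `W(t) ≤ W₀` on `(−ρ², 0)`.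

For `λ`-DSS solutions both inputs follow from the local energy class (2.4c): the near field by the
`L^{10/3}` interpolation, the far field by the LINEAR growth `sup_t ∫_{B(0,R)}|u(t)|² ≲ R` forced by
the self-similarity (file `ChaeWolfRemovingDSSHolds.lean`).

## References

* D. Chae, J. Wolf, arXiv:1610.09464, §2 Step 2 (2.4b) and Step 4 (p. 5–7). [ChaeWolf2017RemovingDSS]
* D. Chae, R. Shvydkoy, Arch. Ration. Mech. Anal. 209 (2013), §3.2.1 Lemma 3.3. [ChaeShvydkoy2013]
-/

noncomputable section

open MeasureTheory TopologicalSpace Set Function Filter Metric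
open _root_.Topology
open scoped Laplacian InnerProductSpace RealInnerProductSpace ENNReal NNReal ContDiff Convolution

namespace Literature.Analysis.FluidPDE

namespace ChaeWolfEnergy

open PressureNormalisation PressureNormalisationL3

/-! ### The slice bound of the renormalised pressure by a local quantity -/

section SliceLocal

/-- In `ℝ≥0∞`: `(a + b)^{3/2} ≤ 2^{1/2}(a^{3/2} + b^{3/2})`. [folklore] -/
private theorem rpow_threeHalves_add_le' (a b : ℝ≥0∞) :
    (a + b) ^ (3 / 2 : ℝ) ≤ (2 : ℝ≥0∞) ^ (1 / 2 : ℝ) * (a ^ (3 / 2 : ℝ) + b ^ (3 / 2 : ℝ)) := by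
  have h := ENNReal.rpow_add_le_mul_rpow_add_rpow a b (by norm_num : (1 : ℝ) ≤ 3 / 2)
  norm_num at h
  exact h

/-- **The slice bound, local form.** Let `Θ` be a normed bump of outer radius `ρ` bounded by
`B_Θ`, `pr` a pressure slice with `pr = Q + C` a.e., `Q` locally integrable with
`Q ∈ L^{3/2}(B̄(x₁, ρ))`, and `m = ∫ Θ(y) pr(x₁ − y) dy`. Then `pr − m = Q − (Θ ⋆ Q)(x₁)` a.e.,
`|(Θ ⋆ Q)(x₁)| ≤ B_Θ |B̄_ρ|^{1/3} ‖Q‖_{L^{3/2}(B̄(x₁,ρ))}` (Hölder on the ball), and hence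
`∫⁻_{B(x₁,ρ)} |pr − m|^{3/2} ≤ 2^{1/2}(1 + |B_ρ| (B_Θ |B̄_ρ|^{1/3})^{3/2}) ∫⁻_{B̄(x₁,ρ)} |Q|^{3/2}`.
[cite: ChaeWolf2017RemovingDSS, §2 Step 4 (arXiv p. 6–7), the pressure normalisation behind "thanks to [gus]"] -/
theorem lintegral_ball_pressure_sub_le_local (x₁ : (EuclideanSpace ℝ (Fin 3)))
    (θ : ContDiffBump (0 : (EuclideanSpace ℝ (Fin 3)))) {BΘ : ℝ} (hBΘ : ∀ y, θ.normed volume y ≤ BΘ)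
    {pr Q : (EuclideanSpace ℝ (Fin 3)) → ℝ} (hQloc : LocallyIntegrable Q volume)
    (hQ32 : MemLp Q (3 / 2) (volume.restrict (closedBall x₁ θ.rOut)))
    {C : ℝ} (hae : ∀ᵐ x ∂(volume : Measure (EuclideanSpace ℝ (Fin 3))), pr x = Q x + C)
    {m : ℝ} (hm : m = ∫ y, θ.normed volume y * pr (x₁ - y)) :
    ∫⁻ x in ball x₁ θ.rOut, ‖pr x - m‖ₑ ^ (3 / 2 : ℝ) ≤
      ENNReal.ofReal ((2 : ℝ) ^ (1 / 2 : ℝ) *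
          (1 + ((volume : Measure (EuclideanSpace ℝ (Fin 3))).real (ball x₁ θ.rOut)) *
            (BΘ * ((volume : Measure (EuclideanSpace ℝ (Fin 3))).real (closedBall x₁ θ.rOut)) ^
              (1 / 3 : ℝ)) ^ (3 / 2 : ℝ))) *
        ∫⁻ x in closedBall x₁ θ.rOut, ‖Q x‖ₑ ^ (3 / 2 : ℝ) := by
  set ρ := θ.rOut with hρ
  set Θ := θ.normed volume with hΘ
  have hΘc : Continuous Θ := θ.continuous_normed
  have hΘcs : HasCompactSupport Θ := θ.hasCompactSupport_normed
  have hBΘ0 : 0 ≤ BΘ := (θ.nonneg_normed 0).trans (hBΘ 0)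
  set V : ℝ := (volume : Measure (EuclideanSpace ℝ (Fin 3))).real (closedBall x₁ ρ) with hV
  set Vb : ℝ := (volume : Measure (EuclideanSpace ℝ (Fin 3))).real (ball x₁ ρ) with hVb
  have hV0 : 0 ≤ V := measureReal_nonneg
  have hVb0 : 0 ≤ Vb := measureReal_nonneg
  -- the averaged pressure `cQ = ∫ Θ(y) Q(x₁ - y) dy` and `m = cQ + C`
  set cQ : ℝ := ∫ y, Θ y * Q (x₁ - y) with hcQ
  have iQ : Integrable (fun y => Θ y * Q (x₁ - y)) volume :=
    (hΘcs.convolutionExists_left (ContinuousLinearMap.lsmul ℝ ℝ : ℝ →L[ℝ] ℝ →L[ℝ] ℝ) hΘc hQloc x₁).integrable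
  have hae' : ∀ᵐ y ∂(volume : Measure (EuclideanSpace ℝ (Fin 3))), pr (x₁ - y) = Q (x₁ - y) + C :=
    ((volume : Measure (EuclideanSpace ℝ (Fin 3))).measurePreserving_sub_left x₁).quasiMeasurePreserving.ae hae
  have hm' : m = cQ + C := by
    rw [hm]
    calc ∫ y, Θ y * pr (x₁ - y) = ∫ y, (Θ y * Q (x₁ - y) + C * Θ y) := by
          refine integral_congr_ae ?_
          filter_upwards [hae'] with y hy
          rw [hy]; ring
      _ = cQ + C * ∫ y, Θ y := by
          rw [integral_add iQ (θ.integrable_normed.const_mul C), integral_const_mul]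
      _ = cQ + C := by rw [hΘ, θ.integral_normed, mul_one]
  -- the `L^{3/2}` norm of `Q` on the closed ball
  set f : (EuclideanSpace ℝ (Fin 3)) → ℝ := (closedBall x₁ ρ).indicator Q with hf
  have hfLp : MemLp f (3 / 2) volume := (memLp_indicator_iff_restrict measurableSet_closedBall).2 hQ32
  set M : ℝ≥0 := (eLpNorm f (3 / 2) volume).toNNReal with hM
  have hMeq : (M : ℝ≥0∞) = eLpNorm f (3 / 2) volume := ENNReal.coe_toNNReal hfLp.eLpNorm_ne_top
  have hfM : eLpNorm f (3 / 2) volume ≤ M := by rw [hMeq]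
  have h32_0 : (3 / 2 : ℝ≥0∞) ≠ 0 := by norm_num
  have h32_top : (3 / 2 : ℝ≥0∞) ≠ ⊤ := ENNReal.div_ne_top (by norm_num) (by norm_num)
  have h32_1 : (1 : ℝ≥0∞) < 3 / 2 :=
    (ENNReal.lt_div_iff_mul_lt (Or.inl (by norm_num)) (Or.inl (by norm_num))).2 (by norm_num)
  have h32_real : (3 / 2 : ℝ≥0∞).toReal = 3 / 2 := by rw [ENNReal.toReal_div]; norm_num
  -- `M^{3/2} = ∫⁻_{B̄} |Q|^{3/2}`
  have hM32 : (M : ℝ≥0∞) ^ (3 / 2 : ℝ) = ∫⁻ x in closedBall x₁ ρ, ‖Q x‖ₑ ^ (3 / 2 : ℝ) := by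
    rw [hMeq, hf, eLpNorm_indicator_eq_eLpNorm_restrict measurableSet_closedBall,
      eLpNorm_eq_lintegral_rpow_enorm_toReal h32_0 h32_top, h32_real, ← ENNReal.rpow_mul]
    norm_num
  -- `|cQ| ≤ B_Θ ∫_{B̄} |Q| ≤ B_Θ V^{1/3} M`
  have hcQ_le : |cQ| ≤ BΘ * (V ^ (1 / 3 : ℝ) * (M : ℝ)) := by
    rw [hcQ, ← integral_sub_left_eq_self (fun y => Θ y * Q (x₁ - y)) volume x₁]
    simp only [sub_sub_cancel]
    have hF : ∀ y, ‖Θ (x₁ - y) * Q y‖ ≤ BΘ * |Q y| := fun y => by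
      rw [norm_mul, Real.norm_of_nonneg (θ.nonneg_normed _), Real.norm_eq_abs]
      exact mul_le_mul_of_nonneg_right (hBΘ _) (abs_nonneg _)
    have hF0 : ∀ y, ρ < dist y x₁ → Θ (x₁ - y) * Q y = 0 := fun y hy => by
      have : Θ (x₁ - y) = 0 := by
        have hns : x₁ - y ∉ Function.support Θ := by
          rw [hΘ, θ.support_normed_eq, mem_ball_zero_iff, not_lt, ← dist_eq_norm, dist_comm]
          exact hy.le
        simpa [Function.mem_support] using hns
      rw [this, zero_mul]
    have hFm : AEStronglyMeasurable (fun y => Θ (x₁ - y) * Q y) volume :=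
      ((hΘc.comp (continuous_const.sub continuous_id)).aestronglyMeasurable).mul
        hQloc.aestronglyMeasurable
    obtain ⟨-, hI⟩ := norm_integral_le_of_kernel_bound
      ((hQloc.integrableOn_isCompact (isCompact_closedBall x₁ ρ)).abs) hFm hF hF0
    rw [← Real.norm_eq_abs]
    refine hI.trans (mul_le_mul_of_nonneg_left ?_ hBΘ0)
    -- Hölder on the ball for the indicator
    have hL1 := setIntegral_norm_le_of_eLpNorm_le hfLp.1 (r := 3 / 2) h32_1.le h32_top hfM x₁ ρ
    have hexp : (1 - ((3 / 2 : ℝ≥0∞).toReal)⁻¹) = 1 / 3 := by rw [h32_real]; norm_num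
    rw [hexp] at hL1
    have hfeq : ∫ y in closedBall x₁ ρ, ‖f y‖ = ∫ y in closedBall x₁ ρ, |Q y| :=
      setIntegral_congr_fun measurableSet_closedBall fun y hy => by
        rw [hf, indicator_of_mem hy, Real.norm_eq_abs]
    rw [← hfeq]
    exact hL1
  -- in `ℝ≥0∞`
  have hcQe : ‖cQ‖ₑ ^ (3 / 2 : ℝ) ≤
      ENNReal.ofReal ((BΘ * V ^ (1 / 3 : ℝ)) ^ (3 / 2 : ℝ)) *
        ∫⁻ x in closedBall x₁ ρ, ‖Q x‖ₑ ^ (3 / 2 : ℝ) := by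
    have h1 : ‖cQ‖ₑ ≤ ENNReal.ofReal (BΘ * V ^ (1 / 3 : ℝ)) * (M : ℝ≥0∞) := by
      rw [Real.enorm_eq_ofReal_abs, ← ENNReal.ofReal_coe_nnreal, ← ENNReal.ofReal_mul (by positivity)]
      exact ENNReal.ofReal_le_ofReal (by rw [← mul_assoc] at hcQ_le; exact hcQ_le)
    calc ‖cQ‖ₑ ^ (3 / 2 : ℝ) ≤ (ENNReal.ofReal (BΘ * V ^ (1 / 3 : ℝ)) * (M : ℝ≥0∞)) ^ (3 / 2 : ℝ) :=
          ENNReal.rpow_le_rpow h1 (by norm_num)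
      _ = _ := by
          rw [ENNReal.mul_rpow_of_nonneg _ _ (by norm_num),
            ENNReal.ofReal_rpow_of_nonneg (by positivity) (by norm_num), hM32]
  -- the pointwise splitting
  have hsplit : ∀ᵐ x ∂(volume.restrict (ball x₁ ρ)),
      ‖pr x - m‖ₑ ^ (3 / 2 : ℝ) ≤ (2 : ℝ≥0∞) ^ (1 / 2 : ℝ) * (‖Q x‖ₑ ^ (3 / 2 : ℝ) + ‖cQ‖ₑ ^ (3 / 2 : ℝ)) := by
    refine ae_restrict_of_ae ?_
    filter_upwards [hae] with x hx
    have e : pr x - m = Q x - cQ := by rw [hx, hm']; ring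
    rw [e]
    calc ‖Q x - cQ‖ₑ ^ (3 / 2 : ℝ) ≤ (‖Q x‖ₑ + ‖cQ‖ₑ) ^ (3 / 2 : ℝ) :=
          ENNReal.rpow_le_rpow (enorm_sub_le) (by norm_num)
      _ ≤ _ := rpow_threeHalves_add_le' _ _
  -- integrate
  set J : ℝ≥0∞ := ∫⁻ x in closedBall x₁ ρ, ‖Q x‖ₑ ^ (3 / 2 : ℝ) with hJ
  have hQball : ∫⁻ x in ball x₁ ρ, ‖Q x‖ₑ ^ (3 / 2 : ℝ) ≤ J := lintegral_mono_set ball_subset_closedBall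
  have hcint : ∫⁻ _ in ball x₁ ρ, ‖cQ‖ₑ ^ (3 / 2 : ℝ) ≤
      ENNReal.ofReal Vb * (ENNReal.ofReal ((BΘ * V ^ (1 / 3 : ℝ)) ^ (3 / 2 : ℝ)) * J) := by
    rw [setLIntegral_const, mul_comm, hVb, ofReal_measureReal (measure_ball_lt_top).ne]
    exact mul_le_mul' le_rfl hcQe
  have h2 : (2 : ℝ≥0∞) ^ (1 / 2 : ℝ) = ENNReal.ofReal ((2 : ℝ) ^ (1 / 2 : ℝ)) := by
    rw [← ENNReal.ofReal_rpow_of_nonneg (by norm_num : (0:ℝ) ≤ 2) (by norm_num), ENNReal.ofReal_ofNat]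
  calc ∫⁻ x in ball x₁ ρ, ‖pr x - m‖ₑ ^ (3 / 2 : ℝ)
      ≤ ∫⁻ x in ball x₁ ρ, (2 : ℝ≥0∞) ^ (1 / 2 : ℝ) * (‖Q x‖ₑ ^ (3 / 2 : ℝ) + ‖cQ‖ₑ ^ (3 / 2 : ℝ)) :=
        lintegral_mono_ae hsplit
    _ = (2 : ℝ≥0∞) ^ (1 / 2 : ℝ) * ((∫⁻ x in ball x₁ ρ, ‖Q x‖ₑ ^ (3 / 2 : ℝ)) +
          ∫⁻ _ in ball x₁ ρ, ‖cQ‖ₑ ^ (3 / 2 : ℝ)) := by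
        rw [lintegral_const_mul' _ _ (ENNReal.rpow_ne_top_of_nonneg (by norm_num) ENNReal.ofNat_ne_top),
          lintegral_add_right _ measurable_const]
    _ ≤ (2 : ℝ≥0∞) ^ (1 / 2 : ℝ) * (J +
          ENNReal.ofReal Vb * (ENNReal.ofReal ((BΘ * V ^ (1 / 3 : ℝ)) ^ (3 / 2 : ℝ)) * J)) := by
        gcongr
    _ = ENNReal.ofReal ((2 : ℝ) ^ (1 / 2 : ℝ) * (1 + Vb * (BΘ * V ^ (1 / 3 : ℝ)) ^ (3 / 2 : ℝ))) * J := by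
        rw [h2, ENNReal.ofReal_mul (by positivity), ENNReal.ofReal_add zero_le_one (by positivity),
          ENNReal.ofReal_one, ENNReal.ofReal_mul hVb0]
        ring

end SliceLocal

/-! ### The pressure class from near-field and far-field inputs -/

section PressureClass

variable {u : ℝ → (EuclideanSpace ℝ (Fin 3)) → (EuclideanSpace ℝ (Fin 3))}
  {p : ℝ → (EuclideanSpace ℝ (Fin 3)) → ℝ}

/-- **The renormalised pressure is in `L^{3/2}` of a cylinder up to the top, for every exponent
`q ≥ 3`, from a near-field `L³` input and a far-field energy input.** Let `(u, p)` be a classical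
solution of the unforced system (`ν = 1`) on `ℝ³ × (−∞, 0)` with `u(t) ∈ L^q`, `3 ≤ q`, and a rate
`‖u(t)‖_{L^q} ≤ K₀(−t)^{−κ}` on `(−T, 0)` (only used to normalise the pressure slices,
`p(t) = Q(t) + C(t)` with `Q(t)` the `L^{q/2}` weak-Poisson pressure), let `x₀ ∈ ℝ³`, `0 < ρ`,
`ρ² < T`, and assume
(near field) `∫∫_{Q_{4ρ}(0, x₀)} |u|³ < ∞` and
(far field) `∫_{|y| ≥ 4ρ} |u(t, x₀ + y)|²/|y|³ ≤ W₀` for all `t ∈ (−ρ², 0)`.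
Then there is `m`, smooth on `(−∞, 0)`, with `(u, p − m)` classical on `Q_ρ(0, x₀)` and
`p − m ∈ L^{3/2}(Q_ρ(0, x₀))`. Slice by slice: `lintegral_ball_pressure_sub_le_local` and the
near/far splitting `exists_setIntegral_abs_rpow_threeHalves_le` (Chae–Shvydkoy 2013, Lemma 3.3) at
the centre `x₀` (applied to the translated solution `u(·, x₀ + ·)`), then Tonelli.
[cite: ChaeWolf2017RemovingDSS, §2 Step 4 (arXiv p. 6–7); ChaeShvydkoy2013, §3.2.1 Lemma 3.3] -/
theorem _root_.Literature.Analysis.FluidPDE.IsClassicalNSSolutionOn.exists_pressure_class_of_farField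
    (hsol : IsClassicalNSSolutionOn (Iio 0) 1 0 u p)
    {q : ℝ} (hq : 3 ≤ q) {κ K₀ T : ℝ} (hκ : 0 ≤ κ) (hK₀ : 0 ≤ K₀)
    (hLq : ∀ t ∈ Ioo (-T) 0, MemLp (u t) (ENNReal.ofReal q) volume)
    (hrate : ∀ t ∈ Ioo (-T) 0,
      eLpNorm (u t) (ENNReal.ofReal q) volume ≤ ENNReal.ofReal (K₀ * (-t) ^ (-κ)))
    (x₀ : (EuclideanSpace ℝ (Fin 3))) {ρ : ℝ} (hρ : 0 < ρ) (hρT : ρ ^ 2 < T)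
    (hL3 : ∫⁻ w in parabolicCylinder (4 * ρ) ((0 : ℝ), x₀), ‖u w.1 w.2‖ₑ ^ (3 : ℕ) < ⊤)
    {W₀ : ℝ} (hW : ∀ t ∈ Ioo (-ρ ^ 2) 0,
      ∫ y in (ball (0 : EuclideanSpace ℝ (Fin 3)) (4 * ρ))ᶜ, ‖u t (x₀ + y)‖ ^ 2 / ‖y‖ ^ 3 ≤ W₀) :
    ∃ m : ℝ → ℝ, ContDiffOn ℝ ∞ m (Iio 0) ∧
      IsClassicalNSSolutionOnRegion (parabolicCylinder ρ ((0 : ℝ), x₀)) 1 0 u (fun t x => p t x - m t) ∧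
      MemLp (uncurry fun t x => p t x - m t) (3 / 2)
        (volume.restrict (parabolicCylinder ρ ((0 : ℝ), x₀))) := by
  have hS : IsOpen (Iio (0 : ℝ)) := isOpen_Iio
  have hq2 : (2 : ℝ) < q := by linarith
  have hq0 : 0 < q := by linarith
  -- the bump at scale `ρ` and the normaliser
  let θ : ContDiffBump (0 : (EuclideanSpace ℝ (Fin 3))) := ⟨ρ / 2, ρ, by positivity, by linarith⟩
  have hθρ : θ.rOut = ρ := rfl
  obtain ⟨m, hm, hmval⟩ := exists_smooth_normaliser hsol hS x₀ θ
  refine ⟨m, hm, isClassicalNSSolutionOnRegion_sub_normaliser hsol hm x₀ ρ, ?_⟩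
  -- the sup of the normed bump
  set BΘ : ℝ := 1 / (volume : Measure (EuclideanSpace ℝ (Fin 3))).real (closedBall (0 : (EuclideanSpace ℝ (Fin 3))) θ.rIn) with hBΘ
  have hBΘle : ∀ y, θ.normed volume y ≤ BΘ := fun y => θ.normed_le_div_measure_closedBall_rIn volume y
  have hBΘ0 : 0 ≤ BΘ := (θ.nonneg_normed 0).trans (hBΘle 0)
  -- ## the translated solution `ũ = u(·, x₀ + ·)` and its slice pressures
  set ut : ℝ → (EuclideanSpace ℝ (Fin 3)) → (EuclideanSpace ℝ (Fin 3)) := fun t x => u t (x₀ + x) with hut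
  set pt : ℝ → (EuclideanSpace ℝ (Fin 3)) → ℝ := fun t x => p t (x₀ + x) with hpt
  have hsolt : IsClassicalNSSolutionOn (Iio 0) 1 0 ut pt := by
    have h := hsol.spaceTranslate x₀
    exact h
  have hmp : MeasurePreserving (fun x : EuclideanSpace ℝ (Fin 3) => x₀ + x) volume volume :=
    measurePreserving_add_left volume x₀
  have hme : MeasurableEmbedding (fun x : EuclideanSpace ℝ (Fin 3) => x₀ + x) :=
    (Homeomorph.addLeft x₀).measurableEmbedding
  have hutr : ∀ t, ut t = u t ∘ (fun x => x₀ + x) := fun t => rfl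
  have hLqt : ∀ t ∈ Ioo (-T) 0, MemLp (ut t) (ENNReal.ofReal q) volume := fun t ht => by
    rw [hutr t]; exact (hLq t ht).comp_measurePreserving hmp
  have hratet : ∀ t ∈ Ioo (-T) 0,
      eLpNorm (ut t) (ENNReal.ofReal q) volume ≤ ENNReal.ofReal (K₀ * (-t) ^ (-κ)) := fun t ht => by
    rw [hutr t, eLpNorm_comp_measurePreserving (hLq t ht).1 hmp]; exact hrate t ht
  obtain ⟨Cq, hQex⟩ := exists_rieszPressure_slice_of_rate hsolt hq2 hκ hK₀ hLqt hratet
  choose! Qt hQt hQtb hQteq Ct hCt using hQex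
  -- ## the near/far splitting constants
  obtain ⟨A, B, hA0, hB0, hAB⟩ := exists_setIntegral_abs_rpow_threeHalves_le
  -- ## the slice bound on `(−ρ², 0)`
  have hρ2 : 0 < 2 * ρ := by positivity
  set V : ℝ := (volume : Measure (EuclideanSpace ℝ (Fin 3))).real (closedBall (0 : EuclideanSpace ℝ (Fin 3)) ρ) with hV
  set Vb : ℝ := (volume : Measure (EuclideanSpace ℝ (Fin 3))).real (ball (0 : EuclideanSpace ℝ (Fin 3)) ρ) with hVb
  set c₁ : ℝ := (2 : ℝ) ^ (1 / 2 : ℝ) * (1 + Vb * (BΘ * V ^ (1 / 3 : ℝ)) ^ (3 / 2 : ℝ)) with hc₁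
  have hc₁0 : 0 ≤ c₁ := by positivity
  set Nt : ℝ → ℝ≥0∞ := fun t => ∫⁻ y in ball x₀ (4 * ρ), ‖u t y‖ₑ ^ (3 : ℕ) with hNt
  have hIoo : Ioo (-ρ ^ 2) 0 ⊆ Ioo (-T) 0 := fun s hs => ⟨by linarith [hs.1], hs.2⟩
  have hslice : ∀ t ∈ Ioo (-ρ ^ 2) 0,
      ∫⁻ x in ball x₀ ρ, ‖p t x - m t‖ₑ ^ (3 / 2 : ℝ) ≤
        ENNReal.ofReal c₁ * (ENNReal.ofReal A * Nt t +
          ENNReal.ofReal (B * (2 * ρ) ^ 3 * W₀ ^ (3 / 2 : ℝ))) := by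
    intro t ht
    have ht' : t ∈ Ioo (-T) 0 := hIoo ht
    have ht0 : t < 0 := ht.2
    have huc : Continuous (u t) := (hsol.contDiff_velocity ht0).continuous
    have hutc : Continuous (ut t) := huc.comp (continuous_const.add continuous_id)
    -- translate the slice integral to the centre `0`
    have htrans : ∫⁻ x in ball x₀ ρ, ‖p t x - m t‖ₑ ^ (3 / 2 : ℝ) =
        ∫⁻ y in ball (0 : EuclideanSpace ℝ (Fin 3)) ρ, ‖pt t y - m t‖ₑ ^ (3 / 2 : ℝ) := by
      have hpre : (fun x : EuclideanSpace ℝ (Fin 3) => x₀ + x) ⁻¹' ball x₀ ρ =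
          ball (0 : EuclideanSpace ℝ (Fin 3)) ρ := by
        ext y; simp [mem_ball, dist_eq_norm]
      rw [← hpre]
      exact (hmp.setLIntegral_comp_preimage_emb hme (fun x => ‖p t x - m t‖ₑ ^ (3 / 2 : ℝ))
        (ball x₀ ρ)).symm
    -- `m t` as the average of the translated pressure
    have hmt : m t = ∫ y, θ.normed volume y * pt t (0 - y) := by
      rw [hmval t ht0]
      refine integral_congr_ae (Eventually.of_forall fun y => ?_)
      simp only [hpt, zero_sub, ← sub_eq_add_neg]
    -- the local `L^{3/2}` class of the slice pressure
    haveI : IsFiniteMeasure (volume.restrict (closedBall (0 : EuclideanSpace ℝ (Fin 3)) ρ)) :=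
      isFiniteMeasure_restrict.2 measure_closedBall_lt_top.ne
    have hq21 : (1 : ℝ≥0∞) ≤ ENNReal.ofReal (q / 2) := by
      rw [← ENNReal.ofReal_one]; exact ENNReal.ofReal_le_ofReal (by linarith)
    have hQ32 : MemLp (Qt t) (3 / 2) (volume.restrict (closedBall (0 : EuclideanSpace ℝ (Fin 3)) ρ)) := by
      refine ((hQt t ht').restrict _).mono_exponent ?_
      rw [show (3 / 2 : ℝ≥0∞) = ENNReal.ofReal (3 / 2) by
        rw [ENNReal.ofReal_div_of_pos two_pos]; norm_num]
      exact ENNReal.ofReal_le_ofReal (by linarith)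
    have hQloc : LocallyIntegrable (Qt t) volume := (hQt t ht').locallyIntegrable hq21
    -- the local slice bound at the centre `0`
    have key := lintegral_ball_pressure_sub_le_local 0 θ hBΘle hQloc hQ32 (hCt t ht') hmt
    rw [hθρ] at key
    -- the near/far splitting at scale `L = 2ρ`
    have hsplit := hAB hq hutc (hLqt t ht') (hQt t ht') (hQteq t ht') hρ2
    have h4 : 2 * (2 * ρ) = 4 * ρ := by ring
    rw [h4] at hsplit
    -- `∫⁻_{B̄_ρ} |Q|^{3/2} ≤ ofReal (∫_{B_{2ρ}} |Q|^{3/2})`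
    have hQ32' : MemLp (Qt t) (3 / 2) (volume.restrict (ball (0 : EuclideanSpace ℝ (Fin 3)) (2 * ρ))) := by
      haveI : IsFiniteMeasure (volume.restrict (ball (0 : EuclideanSpace ℝ (Fin 3)) (2 * ρ))) :=
        isFiniteMeasure_restrict.2 measure_ball_lt_top.ne
      refine ((hQt t ht').restrict _).mono_exponent ?_
      rw [show (3 / 2 : ℝ≥0∞) = ENNReal.ofReal (3 / 2) by
        rw [ENNReal.ofReal_div_of_pos two_pos]; norm_num]
      exact ENNReal.ofReal_le_ofReal (by linarith)
    have hQi : IntegrableOn (fun x => |Qt t x| ^ (3 / 2 : ℝ)) (ball (0 : EuclideanSpace ℝ (Fin 3)) (2 * ρ)) volume := by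
      have h := hQ32'.integrable_norm_rpow (by norm_num) (ENNReal.div_ne_top (by norm_num) (by norm_num))
      refine h.congr (Eventually.of_forall fun x => ?_)
      simp only [Real.norm_eq_abs]
      rw [ENNReal.toReal_div]; norm_num
    have hJle : ∫⁻ x in closedBall (0 : EuclideanSpace ℝ (Fin 3)) ρ, ‖Qt t x‖ₑ ^ (3 / 2 : ℝ) ≤
        ENNReal.ofReal (∫ x in ball (0 : EuclideanSpace ℝ (Fin 3)) (2 * ρ), |Qt t x| ^ (3 / 2 : ℝ)) := by
      have hsub : closedBall (0 : EuclideanSpace ℝ (Fin 3)) ρ ⊆ ball 0 (2 * ρ) :=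
        closedBall_subset_ball (by linarith)
      refine (lintegral_mono_set hsub).trans (le_of_eq ?_)
      rw [ofReal_integral_eq_lintegral_ofReal hQi (ae_of_all _ fun x => by positivity)]
      refine lintegral_congr fun x => ?_
      rw [Real.enorm_eq_ofReal_abs, ENNReal.ofReal_rpow_of_nonneg (abs_nonneg _) (by norm_num)]
    -- the near-field term in `ℝ≥0∞`
    have hnear : ENNReal.ofReal (∫ y in ball (0 : EuclideanSpace ℝ (Fin 3)) (4 * ρ), ‖ut t y‖ ^ (3 : ℝ)) = Nt t := by
      have hint : IntegrableOn (fun y => ‖ut t y‖ ^ (3 : ℝ)) (ball (0 : EuclideanSpace ℝ (Fin 3)) (4 * ρ)) volume :=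
        ((hutc.norm.rpow_const fun _ => Or.inr (by norm_num)).continuousOn.integrableOn_compact
          (isCompact_closedBall _ _)).mono_set ball_subset_closedBall
      rw [ofReal_integral_eq_lintegral_ofReal hint (ae_of_all _ fun y => by positivity)]
      have hpre : (fun x : EuclideanSpace ℝ (Fin 3) => x₀ + x) ⁻¹' ball x₀ (4 * ρ) =
          ball (0 : EuclideanSpace ℝ (Fin 3)) (4 * ρ) := by
        ext y; simp [mem_ball, dist_eq_norm]
      have e1 : ∫⁻ y in ball (0 : EuclideanSpace ℝ (Fin 3)) (4 * ρ), ENNReal.ofReal (‖ut t y‖ ^ (3 : ℝ)) =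
          ∫⁻ y in ball (0 : EuclideanSpace ℝ (Fin 3)) (4 * ρ), ‖u t (x₀ + y)‖ₑ ^ (3 : ℕ) := by
        refine lintegral_congr fun y => ?_
        rw [← ofReal_norm, ← ENNReal.ofReal_pow (norm_nonneg _),
          show (3 : ℝ) = ((3 : ℕ) : ℝ) by norm_num, Real.rpow_natCast]
      rw [e1, hNt]
      show _ = ∫⁻ y in ball x₀ (4 * ρ), ‖u t y‖ₑ ^ (3 : ℕ)
      rw [← hpre]
      exact hmp.setLIntegral_comp_preimage_emb hme (fun y => ‖u t y‖ₑ ^ (3 : ℕ)) (ball x₀ (4 * ρ))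
    -- the far-field term
    have hWt := hW t ht
    have hW0' : 0 ≤ ∫ y in (ball (0 : EuclideanSpace ℝ (Fin 3)) (4 * ρ))ᶜ, ‖ut t y‖ ^ 2 / ‖y‖ ^ 3 :=
      integral_nonneg fun y => by positivity
    have hfar : B * (2 * ρ) ^ 3 *
        (∫ y in (ball (0 : EuclideanSpace ℝ (Fin 3)) (4 * ρ))ᶜ, ‖ut t y‖ ^ 2 / ‖y‖ ^ 3) ^ (3 / 2 : ℝ) ≤
        B * (2 * ρ) ^ 3 * W₀ ^ (3 / 2 : ℝ) := by
      have : (∫ y in (ball (0 : EuclideanSpace ℝ (Fin 3)) (4 * ρ))ᶜ, ‖ut t y‖ ^ 2 / ‖y‖ ^ 3) ^ (3 / 2 : ℝ) ≤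
          W₀ ^ (3 / 2 : ℝ) := Real.rpow_le_rpow hW0' hWt (by norm_num)
      exact mul_le_mul_of_nonneg_left this (by positivity)
    -- assemble the slice bound
    rw [htrans]
    refine key.trans ?_
    rw [← hc₁]
    refine mul_le_mul' le_rfl (hJle.trans ?_)
    calc ENNReal.ofReal (∫ x in ball (0 : EuclideanSpace ℝ (Fin 3)) (2 * ρ), |Qt t x| ^ (3 / 2 : ℝ))
        ≤ ENNReal.ofReal (A * (∫ y in ball (0 : EuclideanSpace ℝ (Fin 3)) (4 * ρ), ‖ut t y‖ ^ (3 : ℝ)) +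
            B * (2 * ρ) ^ 3 * W₀ ^ (3 / 2 : ℝ)) :=
          ENNReal.ofReal_le_ofReal (hsplit.trans (by linarith [hfar]))
      _ = ENNReal.ofReal A * Nt t + ENNReal.ofReal (B * (2 * ρ) ^ 3 * W₀ ^ (3 / 2 : ℝ)) := by
          rw [ENNReal.ofReal_add (by positivity) (by
              have := Real.rpow_nonneg (le_trans hW0' hWt) (3 / 2 : ℝ)
              positivity),
            ENNReal.ofReal_mul hA0, hnear]
  -- ## the `L^{3/2}` class by Tonelli
  have hcyl_sub : parabolicCylinder ρ ((0 : ℝ), x₀) ⊆ Iio (0 : ℝ) ×ˢ (univ : Set (EuclideanSpace ℝ (Fin 3))) := by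
    intro w hw
    rw [mem_parabolicCylinder] at hw
    exact ⟨(hw.1.2 : w.1 < 0), mem_univ _⟩
  have hcont : ContinuousOn (uncurry fun t x => p t x - m t) (Iio 0 ×ˢ univ) :=
    hsol.smooth_pressure.continuousOn.sub (hm.continuousOn.comp continuousOn_fst fun w hw => hw.1)
  have hmeas : AEStronglyMeasurable (uncurry fun t x => p t x - m t)
      (volume.restrict (parabolicCylinder ρ ((0 : ℝ), x₀))) :=
    (hcont.mono hcyl_sub).aestronglyMeasurable (isOpen_parabolicCylinder _ _).measurableSet
  refine ⟨hmeas, ?_⟩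
  have h32 : ((3 / 2 : ℝ≥0∞)).toReal = (3 / 2 : ℝ) := by rw [ENNReal.toReal_div]; norm_num
  have h0 : (3 / 2 : ℝ≥0∞) ≠ 0 := by norm_num
  have htop : (3 / 2 : ℝ≥0∞) ≠ ⊤ := ENNReal.div_ne_top (by norm_num) (by norm_num)
  rw [eLpNorm_lt_top_iff_lintegral_rpow_enorm_lt_top h0 htop, h32]
  set F : ℝ × (EuclideanSpace ℝ (Fin 3)) → ℝ≥0∞ := fun w => ‖p w.1 w.2 - m w.1‖ₑ ^ (3 / 2 : ℝ) with hF
  have cF : ContinuousOn F (Iio 0 ×ˢ univ) := by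
    have h1 : ContinuousOn (fun w : ℝ × (EuclideanSpace ℝ (Fin 3)) => ‖p w.1 w.2 - m w.1‖ₑ) (Iio 0 ×ˢ univ) :=
      continuous_enorm.comp_continuousOn hcont
    exact (ENNReal.continuous_rpow_const.comp_continuousOn h1)
  show ∫⁻ w in parabolicCylinder ρ ((0 : ℝ), x₀), F w < ⊤
  have hvol : (volume : Measure (ℝ × (EuclideanSpace ℝ (Fin 3)))) =
      (volume : Measure ℝ).prod (volume : Measure (EuclideanSpace ℝ (Fin 3))) := rfl
  have hFm : AEMeasurable F ((volume.restrict (Ioo (0 - ρ ^ 2) 0)).prod (volume.restrict (ball x₀ ρ))) := by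
    rw [Measure.prod_restrict]
    exact (cF.mono hcyl_sub).aemeasurable (measurableSet_Ioo.prod measurableSet_ball)
  rw [parabolicCylinder, hvol, ← Measure.prod_restrict, lintegral_prod _ hFm]
  -- the near-field space–time integral dominates `∫ Nt`
  have hu3 : ContinuousOn (fun w : ℝ × (EuclideanSpace ℝ (Fin 3)) => ‖u w.1 w.2‖ₑ ^ (3 : ℕ)) (Iio 0 ×ˢ univ) :=
    (ENNReal.continuous_pow 3).comp_continuousOn
      (continuous_enorm.comp_continuousOn hsol.smooth_velocity.continuousOn)
  have hNm : AEMeasurable (fun w : ℝ × (EuclideanSpace ℝ (Fin 3)) => ‖u w.1 w.2‖ₑ ^ (3 : ℕ))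
      ((volume.restrict (Ioo (0 - ρ ^ 2) 0)).prod (volume.restrict (ball x₀ (4 * ρ)))) := by
    rw [Measure.prod_restrict]
    refine (hu3.mono ?_).aemeasurable (measurableSet_Ioo.prod measurableSet_ball)
    exact prod_mono (fun s hs => (hs.2 : s < 0)) (subset_univ _)
  have hNint : ∫⁻ s in Ioo (0 - ρ ^ 2) 0, Nt s ≤
      ∫⁻ w in parabolicCylinder (4 * ρ) ((0 : ℝ), x₀), ‖u w.1 w.2‖ₑ ^ (3 : ℕ) := by
    have e1 : ∫⁻ s in Ioo (0 - ρ ^ 2) 0, Nt s =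
        ∫⁻ w in Ioo (0 - ρ ^ 2) 0 ×ˢ ball x₀ (4 * ρ), ‖u w.1 w.2‖ₑ ^ (3 : ℕ) := by
      rw [hvol, ← Measure.prod_restrict, lintegral_prod _ hNm]
    rw [e1]
    refine lintegral_mono_set ?_
    rw [parabolicCylinder]
    exact prod_mono (Ioo_subset_Ioo (by nlinarith) le_rfl) subset_rfl
  have hρ22 : (0 : ℝ) - ρ ^ 2 = -ρ ^ 2 := by ring
  calc ∫⁻ s in Ioo ((0 : ℝ) - ρ ^ 2) 0, ∫⁻ x in ball x₀ ρ, F (s, x)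
      ≤ ∫⁻ s in Ioo ((0 : ℝ) - ρ ^ 2) 0, ENNReal.ofReal c₁ * (ENNReal.ofReal A * Nt s +
          ENNReal.ofReal (B * (2 * ρ) ^ 3 * W₀ ^ (3 / 2 : ℝ))) :=
        setLIntegral_mono' measurableSet_Ioo fun s hs => hslice s (by rw [hρ22] at hs; exact hs)
    _ = ENNReal.ofReal c₁ * (ENNReal.ofReal A * (∫⁻ s in Ioo ((0 : ℝ) - ρ ^ 2) 0, Nt s) +
          ENNReal.ofReal (B * (2 * ρ) ^ 3 * W₀ ^ (3 / 2 : ℝ)) * volume (Ioo ((0 : ℝ) - ρ ^ 2) 0)) := by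
        rw [lintegral_const_mul' _ _ ENNReal.ofReal_ne_top,
          lintegral_add_right _ measurable_const, lintegral_const_mul' _ _ ENNReal.ofReal_ne_top,
          setLIntegral_const]
    _ < ⊤ := by
        refine ENNReal.mul_lt_top ENNReal.ofReal_lt_top ?_
        refine ENNReal.add_lt_top.2 ⟨ENNReal.mul_lt_top ENNReal.ofReal_lt_top (lt_of_le_of_lt hNint hL3), ?_⟩
        exact ENNReal.mul_lt_top ENNReal.ofReal_lt_top measure_Ioo_lt_top

end PressureClass

end ChaeWolfEnergy

end Literature.Analysis.FluidPDE

end
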